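import Summits.QuantumAdvantage.QuantumAdvantage.Theorems.SosSandwichTransferPBEventMachine
import Summits.QuantumAdvantage.QuantumAdvantage.Theorems.SosSandwichTransferPBEventMachineInv
import Summits.QuantumAdvantage.QuantumAdvantage.Theorems.SosSandwichTransferPBWalkMachineFinal
import Literature.Computability.Complexity.OracleStateMachine
import Literature.Computability.Complexity.OracleComposition
import HarnessLib

/-!
# Crux `TransferPB` (stmt-QuantumAdvantage-15238, route SosSandwich), line `birth` — the stub from (Q) and an `OSM` implementing the event machine

The machine half of stub `stub_pbOracleSimulation` is reduced to THREE LOOP-FREE `FP` STRING MAPS. The event machine of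
`Theorems/SosSandwichTransferPBEventMachineDefs.lean` (runs: `…EventMachine.lean`; size invariant: `…EventMachineInv.lean`)
has the shape of the tree's state-machine toolkit `Literature/Computability/Complexity/OracleStateMachine.lean` (`OSM`:
`ini/del/kap`; `OSM.isPolyTime_alg`: polynomial time from `ini, del, kap ∈ FP` with additively growing states — the
replay of the transcript is done once and for all there). This file does the glue:

* `exists_step_eq_of_mem_queriesAux` (a transcript query is a step query), **`isPolyTime_mapOut_decodeBool`** (generic:
  re-presenting the list outputs of a polynomial-time `OracleAlg (List Bool)` as bits keeps polynomial time — the step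
  code is post-composed with an `FP` normaliser);
* for an `OSM` `S` whose maps CODE the event machine at input `x` (`S.ini x` codes `evInit D`; `S.del` codes `evDelta W`
  and `S.kap` codes `evKappa x` on the codes of states satisfying `EvInv W D`): `osm_state_eq`, `osm_step_eq`,
  `osm_loop_eq`, **`run_osm_mapOut`** (runs of `S.alg.mapOut decodeBool` with a language oracle = `evLoop` from
  `evInit D`), **`length_le_of_mem_queries_osm_mapOut`** (its queries are `≤ evQueryBound W D |x|` long, any oracle);
* `boolIndicator_combined_true/false`, `length_liveLevel_strPath_le`, `strPath_step_descentPick` (the consistency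
  invariant "the path is an index path", as in `Theorems/SosSandwichTransferPBWalkMachineCount.lean`);
* **`stub_pbOracleSimulation_of_eventOSM`** — the registered stub follows from
  (Q) `∀ c k F uniform r, nodeProblem F r c k ∈ PromiseBQP` and
  (E) for every two polynomials `pw, pd`: an `OSM` with `ini, del, kap ∈ FP`, `|del ⟨x,⟨st,[b]⟩⟩| ≤ |st| + G(|x|)`,
      coding `evInit (pd |x|)` / `evDelta (pw |x|)` / `evKappa x` as above
  (via `stub_pbOracleSimulation_of_stringMachines` of `Theorems/SosSandwichTransferPBDescentWalk.lean`, with the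
  width/budget polynomials of `Theorems/SosSandwichTransferPBWalkMachineFinal.lean`).

(E) replaces the programming fact (P') of `Theorems/SosSandwichTransferPBWalkMachineFinal.lean` (polynomial time of the
five-fold nested replay `machineStepR`) by three single-transition brick programs with no loop to clock. All proved; (Q)
and (E) are plain `Prop` arguments (no named fact).
Sources: S. Aaronson, A. Ambainis, Theory Comput. 10 (2014), proof of Thm. 23 (p. 14); S. Arora, B. Barak,
Computational Complexity (CUP 2009), §3.4, §1.3.
-/

-- D-0017: single-conjunct summit ⇒ the duplicate `QuantumAdvantage.QuantumAdvantage` is mandated.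
set_option linter.dupNamespace false

noncomputable section

namespace Summit.QuantumAdvantage.QuantumAdvantage.Cruxes.TransferPB.Birth

open Finset Literature.Computability.Cryptography Literature.Computability.Complexity
  Literature.Computability.QuantumComplexity Literature.Computability.QuantumComplexity.ClassicalSimulation

namespace SimTreePB


section Generic

open Literature.Computability.Complexity.OracleAlg

variable {β : Type}

/-- A query in a fuelled transcript is the step function's query at some answer list. [folklore] -/
theorem exists_step_eq_of_mem_queriesAux (M : OracleAlg β) (O : Oracle) (x : List Bool) {y : List Bool} :
    ∀ (k : ℕ) (pre : List (List Bool)), y ∈ M.queriesAux O x k pre → ∃ ans : List (List Bool), M.step x ans = Sum.inl y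
  | 0, pre, h => by simp at h
  | k + 1, pre, h => by
    rw [OracleAlg.queriesAux] at h
    cases hs : M.step x pre with
    | inl q =>
      rw [hs] at h
      rcases List.mem_cons.1 h with rfl | h
      · exact ⟨pre, hs⟩
      · exact exists_step_eq_of_mem_queriesAux M O x k _ h
    | inr b => rw [hs] at h; simp at h

/-- **Re-presenting list outputs as bits keeps polynomial time**: if `M : OracleAlg (List Bool)` has a polynomial-time
step function, so has `M.mapOut decodeBool` (post-compose the step code with the `FP` map
`1 o ↦ 1 [decodeBool o]`, `0 q ↦ 0 q`). [cite: AroraBarak2009, §1.3 (closure of polynomial time under composition)] -/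
theorem isPolyTime_mapOut_decodeBool {M : OracleAlg (List Bool)}
    (h : M.IsPolyTime (Computability.encodingList Bool)) :
    (M.mapOut Computability.decodeBool).IsPolyTime Computability.encodingBoolBool := by
  -- the output normaliser
  let φ : List Bool → List Bool :=
    iteFn take1Fn (List.cons true ∘ iteFn (Brick.isNilFn ∘ List.tail) (fun _ => [false]) (take1Fn ∘ List.tail)) id
  have hφ : φ ∈ FP :=
    iteFn_mem_FP take1Fn_mem_FP
      (comp_mem_FP (cons_mem_FP true) (iteFn_mem_FP (comp_mem_FP Brick.isNilFn_mem_FP PRelSigma.tail_mem_FP)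
        (const_mem_FP _) (comp_mem_FP take1Fn_mem_FP PRelSigma.tail_mem_FP)))
      OracleCompose.id_mem_FP
  have hφ0 : ∀ q : List Bool, φ (false :: q) = false :: q := fun q =>
    iteFn_apply_false (by simp [take1Fn])
  have hφ1 : ∀ o : List Bool, φ (true :: o) = [true, Computability.decodeBool o] := by
    intro o
    simp only [φ]
    rw [iteFn_apply_true (by simp [take1Fn]), Function.comp_apply]
    rcases o with _ | ⟨b, o⟩
    · rw [iteFn_apply_true (by simp [Brick.isNilFn])]; rfl
    · rw [iteFn_apply_false (by simp [Brick.isNilFn])]; rfl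
  have h1 : PolyTimeComputable
      (fun p : List Bool × List (List Bool) => boolPair p.1 ((Computability.encodingList Bool).listBool.encode p.2))
      (id : List Bool → List Bool)
      (((Computability.encodingList Bool).sumBool (Computability.encodingList Bool)).encode ∘ Function.uncurry M.step) := h
  have h2 := PolyTimeComputable.comp_holds hφ h1
  have heq : φ ∘ (((Computability.encodingList Bool).sumBool (Computability.encodingList Bool)).encode ∘
      Function.uncurry M.step) =
      ((Computability.encodingList Bool).sumBool Computability.encodingBoolBool).encode ∘
        Function.uncurry (M.mapOut Computability.decodeBool).step := by
    funext p
    obtain ⟨x, ans⟩ := p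
    simp only [Function.comp_apply, Function.uncurry, OracleAlg.mapOut]
    cases M.step x ans with
    | inl q => exact hφ0 q
    | inr o => rw [Sum.map_inr]; exact hφ1 o
  rw [heq] at h2
  exact h2

end Generic

section OSMGlue

open Literature.Computability.Complexity.OracleAlg

variable {S : OSM} {W D : ℕ} {x : List Bool} {enc : EvState → List Bool}
  (hini : S.ini x = enc (evInit D))
  (hdel : ∀ (s : EvState) (b : Bool), EvInv W D s → S.del (boolPair x (boolPair (enc s) [b])) = enc (evDelta W s b))
  (hkap : ∀ s : EvState, EvInv W D s →
    S.kap (boolPair x (enc s)) = Sum.elim (fun q => false :: q) (fun b => [true, b]) (evKappa x s))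
include hini hdel

/-- **The `OSM` state is the code of the event machine's state.** [folklore] -/
theorem osm_state_eq (bits : List Bool) : S.state x bits = enc (evState W D bits) := by
  induction bits using List.reverseRecOn with
  | nil => exact hini
  | append_singleton bits b ih =>
    rw [OSM.state_append_singleton, ih, hdel _ _ (evInv_evState W D bits), evState_append_singleton]

include hkap

/-- The `OSM` algorithm's step is the event machine's action at the state reached on the flattened answers.
[folklore] -/
theorem osm_step_eq (ans : List (List Bool)) :
    S.alg.step x ans = (evKappa x (evState W D ans.flatten)).map id fun b => [b] := by
  show decodeStep (S.kap (boolPair x (S.state x ans.flatten))) = _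
  rw [osm_state_eq hini hdel, hkap _ (evInv_evState W D _)]
  cases evKappa x (evState W D ans.flatten) <;> rfl

/-- **The `OSM` loop is the event machine's loop.** [folklore] -/
theorem osm_loop_eq (Lg : Language Bool) :
    ∀ (n : ℕ) (bits : List Bool), S.loop Lg x n bits =
      (evLoop x W (fun q => Lg.boolIndicator q) n (evState W D bits)).map fun b => [b]
  | 0, bits => rfl
  | n + 1, bits => by
    rw [OSM.loop, osm_state_eq hini hdel, hkap _ (evInv_evState W D _), evLoop]
    cases evKappa x (evState W D bits) with
    | inl q =>
      show S.loop Lg x n (bits ++ [Lg.boolIndicator q]) = _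
      rw [osm_loop_eq Lg n, evState_append_singleton]
    | inr b => rfl

/-- **Runs of the derived bit-output machine** `S.alg.mapOut decodeBool` with a language oracle are the event
machine's loop from `evInit D`. [folklore] -/
theorem run_osm_mapOut (Lg : Language Bool) (n : ℕ) :
    (S.alg.mapOut Computability.decodeBool).run (Oracle.ofLanguage Lg) n x =
      evLoop x W (fun q => Lg.boolIndicator q) n (evInit D) := by
  show (S.alg.mapOut Computability.decodeBool).runAux (Oracle.ofLanguage Lg) x n [] = _
  rw [runAux_mapOut]
  change (S.alg.run (Oracle.ofLanguage Lg) n x).map Computability.decodeBool = _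
  rw [OSM.run_alg, osm_loop_eq hini hdel hkap Lg n []]
  show Option.map _ (Option.map _ (evLoop x W (fun q => Lg.boolIndicator q) n (evInit D))) = _
  cases evLoop x W (fun q => Lg.boolIndicator q) n (evInit D) <;> rfl

/-- **Queries of the derived machine are short**: every query of `S.alg.mapOut decodeBool` on `x` (any oracle, any
fuel) has length `≤ evQueryBound W D |x|`. [folklore] -/
theorem length_le_of_mem_queries_osm_mapOut (O : Oracle) (k : ℕ) {y : List Bool}
    (hy : y ∈ (S.alg.mapOut Computability.decodeBool).queries O k x) : y.length ≤ evQueryBound W D x.length := by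
  change y ∈ (S.alg.mapOut Computability.decodeBool).queriesAux O x k [] at hy
  rw [queriesAux_mapOut] at hy
  obtain ⟨ans, hans⟩ := exists_step_eq_of_mem_queriesAux S.alg O x k [] hy
  rw [osm_step_eq hini hdel hkap] at hans
  cases hq : evKappa x (evState W D ans.flatten) with
  | inl q =>
    rw [hq] at hans
    cases hans
    exact length_query_le W D x (evInv_evState W D _) hq
  | inr b => rw [hq] at hans; cases hans

end OSMGlue

/-! ### The registered stub from (Q) and an `OSM` implementing the event machine -/

section Stub

open Summit.QuantumAdvantage.QuantumAdvantage.Theses.SosSandwich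

variable {F : QCircuitFamily cliffordT} {x : List Bool} {r : Polynomial ℕ} {c k : ℕ} {g : List Bool → Bool}

/-- The combined oracle language `A ⊕ g` answers `true :: v` by `g v`. [folklore] -/
theorem boolIndicator_combined_true (A : Set (List Bool)) (g : List Bool → Bool) (v : List Bool) :
    Set.boolIndicator {w : List Bool | ∃ v : List Bool, (w = false :: v ∧ v ∈ A) ∨ (w = true :: v ∧ g v = true)}
      (true :: v) = g v := by
  have := decodeBool_combined_true A g v
  rwa [Oracle.ofLanguage_apply, Computability.decode_encodeBool] at this

/-- The combined oracle language `A ⊕ g` answers `false :: u` by the indicator of `A`. [folklore] -/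
theorem boolIndicator_combined_false (A : Set (List Bool)) (g : List Bool → Bool) (u : List Bool) :
    Set.boolIndicator {w : List Bool | ∃ v : List Bool, (w = false :: v ∧ v ∈ A) ∨ (w = true :: v ∧ g v = true)}
      (false :: u) = A.boolIndicator u := by
  have := decodeBool_combined_false A g u
  rwa [Oracle.ofLanguage_apply, Computability.decode_encodeBool] at this

/-- Under consistency the live levels at index paths have at most `8T²·2^k·(400·d·(r(n)+1))^c` members (string form).
[cite: BennettBernsteinBrassardVazirani1997, Cor. 3.4] -/
theorem length_liveLevel_strPath_le (hgn : ∀ v ∈ (nodeProblem F r c k).no, g v = false)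
    (ρ : List (Fin (numOracleBits F x) × Bool)) (j : ℕ) :
    (liveLevel (fun u => g (encBlockS x (strPath F x ρ) u)) j).length ≤
      8 * (F.circ x.length).oracleQueries ^ 2 * 2 ^ k * (400 * thm23Degree F x * (r.eval x.length + 1)) ^ c := by
  have hb : (fun u => g (encBlockS x (strPath F x ρ) u)) = fun u => g (encBlock F x ρ u) :=
    funext fun u => by rw [encBlock_eq_encBlockS]
  rw [hb]
  have h := length_liveLevel_le hgn ρ j
  rw [liveBound_eq] at h
  exact_mod_cast h

/-- Under consistency a pick at an index path (any width bound `W' ≥ W`) extends it to an index path. [folklore] -/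
theorem strPath_step_descentPick (hgn : ∀ v ∈ (nodeProblem F r c k).no, g v = false) {W' : ℕ}
    (hW : oracleWidth F x ≤ W') (ρ : List (Fin (numOracleBits F x) × Bool)) {u : List Bool}
    (hu : descentPick (fun u => g (encBlockS x (strPath F x ρ) u)) (fun u => g (encSingleS x (strPath F x ρ) u)) W'
      ((strPath F x ρ).map Prod.fst) = some u) (b : Bool) :
    ∃ ρ' : List (Fin (numOracleBits F x) × Bool), strPath F x ρ ++ [(u, b)] = strPath F x ρ' := by
  have hb : (fun u => g (encBlockS x (strPath F x ρ) u)) = fun u => g (encBlock F x ρ u) :=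
    funext fun u => by rw [encBlock_eq_encBlockS]
  rw [hb, descentPick_eq_of_le hgn ρ _ _ hW] at hu
  obtain ⟨hlt, -, -, -⟩ := descentPick_some_spec hu
  exact ⟨ρ ++ [(bitEquiv F x ⟨u, mem_shortStrings.2 hlt⟩, b)], by rw [strPath_append_singleton, bitString_bitEquiv hlt]⟩

/-- **`stub_pbOracleSimulation` from (Q) and an `OSM` implementing the event machine.** If
(Q) `nodeProblem F r c k ∈ PromiseBQP` for all `c, k`, uniform `F`, `r`, and (E) for every two polynomials `pw, pd`
there is a state machine `S : OSM` (`Literature/Computability/Complexity/OracleStateMachine.lean`) with `FP` maps of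
additive growth and a coding `enc` of states such that, at every input `x` (width bound `W = pw(|x|)`, round budget
`D = pd(|x|)`), `S.ini x` codes `evInit D`, `S.del` codes `evDelta W` on (the codes of) states satisfying the size
invariant `EvInv W D`, and `S.kap` codes `evKappa x` (`0 q` for a query, `1 b` for an output), then the registered stub
`Sig.stub_pbOracleSimulation` holds: the machine is `S.alg.mapOut decodeBool` — polynomial time by `OSM.isPolyTime_alg`,
short queries by `length_query_le`, runs by `evLoop_evInit` (for a uniform `F` with size polynomial `s` the choices
`pw = X + s ≥ oracleWidth`, `pd ≥ machineBudget` of `Theorems/SosSandwichTransferPBWalkMachineFinal.lean`).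
[cite: AaronsonAmbainis2014, Thm. 23 (proof, p. 14)] -/
theorem stub_pbOracleSimulation_of_eventOSM
    (hQ : ∀ (c k : ℕ) (F : QCircuitFamily cliffordT), F.IsUniform → ∀ r : Polynomial ℕ,
      nodeProblem F r c k ∈ Literature.Computability.Cryptography.PromiseBQP)
    (hE : ∀ pw pd : Polynomial ℕ, ∃ (S : OSM) (enc : List Bool → EvState → List Bool) (G : Polynomial ℕ),
      S.ini ∈ FP ∧ S.del ∈ FP ∧ S.kap ∈ FP ∧
      (∀ (x st : List Bool) (b : Bool), (S.del (boolPair x (boolPair st [b]))).length ≤ st.length + G.eval x.length) ∧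
      (∀ x : List Bool, S.ini x = enc x (evInit (pd.eval x.length))) ∧
      (∀ (x : List Bool) (s : EvState) (b : Bool), EvInv (pw.eval x.length) (pd.eval x.length) s →
        S.del (boolPair x (boolPair (enc x s) [b])) = enc x (evDelta (pw.eval x.length) s b)) ∧
      (∀ (x : List Bool) (s : EvState), EvInv (pw.eval x.length) (pd.eval x.length) s →
        S.kap (boolPair x (enc x s)) = Sum.elim (fun q => false :: q) (fun b => [true, b]) (evKappa x s))) :
    Sig.stub_pbOracleSimulation := by
  refine stub_pbOracleSimulation_of_stringMachines hQ fun c k F hF r => ?_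
  obtain ⟨s, hs⟩ := QCircuitFamily.IsUniform.isPolySize' hF
  let Lp : Polynomial ℕ :=
    Polynomial.C 8 * s ^ 2 * Polynomial.C (2 ^ k) * (Polynomial.C 400 * (Polynomial.C 2 * s + 1) * (r + 1)) ^ c
  let pw : Polynomial ℕ := Polynomial.X + s
  let pd : Polynomial ℕ := Polynomial.C 2 * Lp * (r + 1) + 1
  have hLp : ∀ n : ℕ, Lp.eval n = 8 * (s.eval n) ^ 2 * 2 ^ k * (400 * (2 * s.eval n + 1) * (r.eval n + 1)) ^ c := by
    intro n; simp [Lp]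
  have hpw : ∀ n : ℕ, pw.eval n = n + s.eval n := by intro n; simp [pw]
  have hpd : ∀ n : ℕ, pd.eval n = 2 * Lp.eval n * (r.eval n + 1) + 1 := by intro n; simp [pd]
  obtain ⟨S, enc, G, hiniFP, hdelFP, hkapFP, hG, hini, hdel, hkap⟩ := hE pw pd
  let q : Polynomial ℕ :=
    pd * (Polynomial.C 3 * (pw * Lp) + Polynomial.C 2) + Polynomial.C 41 +
      (Polynomial.C 2 * Polynomial.X + Polynomial.C 2 * pd * (Polynomial.C 2 * pw + Polynomial.C 4) + pw + Polynomial.C 50)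
  have hq : ∀ n : ℕ, q.eval n = pd.eval n * (3 * (pw.eval n * Lp.eval n) + 2) + 41 +
      (2 * n + 2 * pd.eval n * (2 * pw.eval n + 4) + pw.eval n + 50) := by
    intro n; simp [q]
  refine ⟨S.alg.mapOut Computability.decodeBool, q,
    isPolyTime_mapOut_decodeBool (S.isPolyTime_alg hiniFP hdelFP hkapFP hG), fun O x y hy => ?_,
    fun x _ g _ hgn => ?_⟩
  · -- query lengths
    have h := length_le_of_mem_queries_osm_mapOut (hini x) (hdel x) (hkap x) O _ hy
    unfold evQueryBound at h
    rw [hq]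
    omega
  · -- runs within the round budget
    have hW : oracleWidth F x ≤ pw.eval x.length := by
      show x.length + F.ancillas x.length ≤ pw.eval x.length
      rw [hpw]
      exact Nat.add_le_add_left (hs x.length).2 _
    have hT : (F.circ x.length).oracleQueries ≤ s.eval x.length :=
      (QCircuit.oracleQueries_le_size _).trans (hs x.length).1
    have hBL : 8 * (F.circ x.length).oracleQueries ^ 2 * 2 ^ k * (400 * thm23Degree F x * (r.eval x.length + 1)) ^ c ≤
        Lp.eval x.length := by
      rw [hLp]; exact liveBoundNat_mono (r := r) (c := c) (k := k) hT
    have hD : machineBudget F x r c k ≤ pd.eval x.length := by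
      rw [machineBudget_eq_nat, hpd]
      gcongr
    refine ⟨pw.eval x.length, pd.eval x.length, hW, hD, fun A => ?_⟩
    rw [run_osm_mapOut (hini x) (hdel x) (hkap x)]
    obtain ⟨m, hm, hrun⟩ := evLoop_evInit x (pw.eval x.length)
      (O := fun q' => Set.boolIndicator {w : List Bool | ∃ v : List Bool,
        (w = false :: v ∧ v ∈ A) ∨ (w = true :: v ∧ g v = true)} q')
      (g := g) (inA := fun u => A.boolIndicator u)
      (boolIndicator_combined_true A g) (boolIndicator_combined_false A g)
      (fun π => ∃ ρ : List (Fin (numOracleBits F x) × Bool), π = strPath F x ρ) ⟨[], (strPath_nil F x).symm⟩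
      (fun π hπ j => by obtain ⟨ρ, rfl⟩ := hπ; exact length_liveLevel_strPath_le hgn ρ j)
      (fun π hπ u hu => by
        obtain ⟨ρ, rfl⟩ := hπ
        obtain ⟨ρ', h⟩ := strPath_step_descentPick hgn hW ρ hu (A.boolIndicator u)
        exact ⟨ρ', h⟩) (pd.eval x.length)
    refine hrun _ (hm.trans ?_)
    have h2 : pd.eval x.length * (3 * (pw.eval x.length * (8 * (F.circ x.length).oracleQueries ^ 2 * 2 ^ k *
        (400 * thm23Degree F x * (r.eval x.length + 1)) ^ c)) + 2) ≤
        pd.eval x.length * (3 * (pw.eval x.length * Lp.eval x.length) + 2) := by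
      gcongr
    rw [hq]
    omega

end Stub

end SimTreePB

end Summit.QuantumAdvantage.QuantumAdvantage.Cruxes.TransferPB.Birth

end
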